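import Literature.NumberTheory.EllipticCurves.HeegnerPointsKolyvaginPrimaryEulerProofs
import HarnessLib

/-!
# The AUGMENTATION of Kolyvagin's derivative: an orbit-constant additive invariant of `y` VANISHES on `P_n`
# (why the E⁰ label (B6) of the carrier-inert Shimura road may be weakened to ORBIT-CONSTANCY of Néron components)
# (cell `bsd-stepL`, seat `bsd-stepL-tam3-p1` g13, owner of 19109's line; `--supports stmt-BirchSwinnertonDyer-19109 --as helper`)

HONEST FRAMING. Pure group-ring algebra in the tree's abstract Kolyvagin–Euler currency (`KolyvaginEuler.grAct`,
`derivElt`, `derivProd`, `kolyvaginPoint`); THEOREMS ONLY (no definition, no named fact, no `sorry`); nothing about any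
curve; no stub closes; 0 classes move (T7); BSD is not proved by any of this.

THE POINT (line card of 19109, PORT MAP (P2) §1). At the exempted ADDITIVE carrier `q₁` of a residual frame (Kodaira IV∕IV*,
`c_{q₁} = 3`, `E⁰(K[n]_w)` uniquely `3`-divisible) the deep-level Kolyvagin class satisfies `loc_w c_M(n) = δ_M(a_n · T)`, `a_n` =
the Néron component of `P_n` in `Φ_w ≅ ℤ/3`; the walk needs it STRICT (`a_n = 0`), and the line feeds this from the label (B6)
«`ys m ∈ E⁰` up to rational torsion». THIS FILE shows that the weaker, orientation-theoretic ORBIT-CONSTANCY «`g • ys m − ys m ∈ E⁰_w`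
for every `g ∈ Gal(K[m]/K)`» (S.-W. Zhang 2001 §4.4 Case 2: CM points with one orientation reduce to ONE component; Néron
functoriality `J⁰ → E⁰`) already forces `a_n = 0` at EVERY conductor `n` having a Kolyvagin prime factor `ℓ` (`p^M ∣ ℓ + 1`,
`p` odd): for an additive map `φ : A → B` constant on the `𝒢`-orbit of `y` (`φ (g • y) = φ y`), every `r ∈ ℤ[𝒢]` acts through its
AUGMENTATION, `φ (r · y) = ε(r) · φ y` (`map_grAct_eq_augment_smul`); `ε(D_ℓ) = Σ_{i ≤ ℓ} i = ℓ(ℓ+1)/2` is divisible by every ODD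
`n ∣ ℓ + 1` (`dvd_augment_derivElt`), hence so is `ε(D_n)` (`dvd_augment_derivProd`), and
`φ (P_n) = #(𝒢/H) · ε(D_n) · φ y` (`map_kolyvaginPoint_eq_card_smul`) vanishes as soon as `n · B = 0`
(`map_kolyvaginPoint_eq_zero_of_orbitConstant`). Reading: `A = E(K[n])`, `B = E(K[n]_w) ⧸ E⁰(K[n]_w)` (`≅ Φ_w(k) = ℤ/3` at the
carrier), `φ` = reduction-component map, `n = p^M = 3^M`. So (B6) can be replaced, for the STRICTNESS input `h49` of the ported walk,
by orbit-constancy; the base class (conductor without Kolyvagin primes) is never asked to be strict by the engine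
(`Koly.tamagawaExponent_le_m_of_orderedFamiliesBase_of_classes`: `h49` binds `κ(s·ℓ)` only). The Kummer-membership inputs at the
OTHER bad places keep their receptacle form (x11b3's END); re-keying them on differences is not done here.
References (locators only): [cite: GrossLMS1991, §3 (3.5), §4 (4.1)] [cite: McCallumLMS1991, §4] [cite: Zhang2001Heights, §4.4,
proof of Prop. 4.4.2, Case 2] [cite: Jetchev2008, Prop. 4.9 (p. 820)].
presearch: augmentation lemma → none as a statement ([corpus: GrossLMS1991 §3 (3.5)] gives `(σ−1)D_ℓ = ℓ+1−Tr_ℓ`, whose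
augmentation is the identity `0 = (ℓ+1) − (ℓ+1)`; `ε(D_ℓ) = ℓ(ℓ+1)/2` is a one-line computation); queries: `lit search --hybrid
"augmentation of the Kolyvagin derivative operator D_l … orbit-invariant homomorphism"` (6 unrelated hits), `lit galaxy search
"Kolyvagin derivative|derivative operator D_|augmentation" --star all` (0 relevant); tree `lean search 'augment'` → none in the
Kolyvagin files. Design: no definitions (the augmentation is the term `MonoidAlgebra.lift ℤ ℤ 𝒢 1`); axioms trio.
-/

set_option autoImplicit false

noncomputable section

open scoped Classical
open Finset Literature.NumberTheory.EllipticCurves Literature.NumberTheory.EllipticCurves.KolyvaginEuler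

namespace Summit.BirchSwinnertonDyer.Rank1Residual.X11b.Three.KolyvaginAugmentation

variable {𝒢 : Type*} [CommGroup 𝒢] {A : Type*} [AddCommGroup A] [DistribMulAction 𝒢 A]
  {B : Type*} [AddCommGroup B]

/-! ### §1 The augmentation `ε : ℤ[𝒢] → ℤ` (the term `MonoidAlgebra.lift ℤ ℤ 𝒢 1`) -/

/-- `ε(γ) = 1`. [folklore] -/
theorem augment_of (g : 𝒢) : MonoidAlgebra.lift ℤ ℤ 𝒢 1 (MonoidAlgebra.of ℤ 𝒢 g) = 1 := by
  rw [MonoidAlgebra.lift_of, MonoidHom.one_apply]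

/-- **An orbit-constant additive invariant sees `ℤ[𝒢]` through the augmentation**: if `φ (g • y) = φ y` for every `g ∈ 𝒢`, then
`φ (r · y) = ε(r) · φ y` for every `r ∈ ℤ[𝒢]`. [folklore] -/
theorem map_grAct_eq_augment_smul (φ : A →+ B) {y : A} (hφ : ∀ g : 𝒢, φ (g • y) = φ y)
    (r : MonoidAlgebra ℤ 𝒢) : φ (grAct A r y) = (MonoidAlgebra.lift ℤ ℤ 𝒢 1 r) • φ y := by
  induction r using MonoidAlgebra.induction_on with
  | hM g => rw [grAct_of, hφ, augment_of, one_smul]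
  | hadd r s hr hs => rw [grAct_add, map_add, hr, hs, map_add, add_smul]
  | hsmul c r hr => rw [grAct_smul, map_zsmul, hr, map_smul, smul_eq_mul, mul_smul]

/-! ### §2 `ε(D_ℓ) = Σ_{i ≤ ℓ} i`, divisible by every odd divisor of `ℓ + 1`; `ε(D_n) = ∏ ε(D_ℓ)` -/

/-- `ε(D_ℓ) = Σ_{i < ℓ+1} i`. [cite: GrossLMS1991, §3 (3.5)] -/
theorem augment_derivElt (σ : 𝒢) (ℓ : ℕ) :
    MonoidAlgebra.lift ℤ ℤ 𝒢 1 (derivElt σ ℓ) = ∑ i ∈ range (ℓ + 1), (i : ℤ) := by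
  unfold derivElt
  rw [map_sum]
  refine sum_congr rfl fun i _ ↦ ?_
  rw [map_mul, map_natCast, augment_of, mul_one]

/-- `2 · ε(D_ℓ) = ℓ (ℓ + 1)` (Gauss). [folklore] -/
theorem two_mul_augment_derivElt (σ : 𝒢) (ℓ : ℕ) :
    2 * MonoidAlgebra.lift ℤ ℤ 𝒢 1 (derivElt σ ℓ) = (ℓ : ℤ) * (ℓ + 1) := by
  rw [augment_derivElt, ← Nat.cast_sum, mul_comm]
  have h := Finset.sum_range_id_mul_two (ℓ + 1)
  rw [Nat.add_sub_cancel] at h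
  have h' : ((∑ i ∈ range (ℓ + 1), i : ℕ) : ℤ) * 2 = ((ℓ + 1 : ℕ) : ℤ) * ℓ := by exact_mod_cast h
  rw [h']
  push_cast
  ring

/-- **`ε(D_ℓ)` is divisible by every ODD `n ∣ ℓ + 1`** (e.g. `n = p^M`, `p` odd, `ℓ` a Kolyvagin prime of depth `M`).
[cite: GrossLMS1991, §3 (3.3), (3.5)] -/
theorem dvd_augment_derivElt (σ : 𝒢) (ℓ : ℕ) {n : ℤ} (hodd : Odd n) (hn : n ∣ (ℓ : ℤ) + 1) :
    n ∣ MonoidAlgebra.lift ℤ ℤ 𝒢 1 (derivElt σ ℓ) := by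
  have h2 : n ∣ 2 * MonoidAlgebra.lift ℤ ℤ 𝒢 1 (derivElt σ ℓ) := by
    rw [two_mul_augment_derivElt]
    exact Dvd.dvd.mul_left hn _
  have hcop : IsCoprime n 2 := by
    obtain ⟨k, rfl⟩ := hodd
    exact ⟨-1, k + 1, by ring⟩
  exact hcop.dvd_of_dvd_mul_left h2

/-- `ε(D_n) = ∏_{ℓ ∈ L} ε(D_ℓ)`. [folklore] -/
theorem augment_derivProd (σ : ℕ → 𝒢) (L : Finset ℕ) :
    MonoidAlgebra.lift ℤ ℤ 𝒢 1 (derivProd σ L) = ∏ ℓ ∈ L, MonoidAlgebra.lift ℤ ℤ 𝒢 1 (derivElt (σ ℓ) ℓ) := by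
  unfold derivProd
  rw [map_prod]

/-- **`ε(D_n)` is divisible by every odd `n ∣ ℓ + 1` for any ONE `ℓ ∈ L`.** [folklore] -/
theorem dvd_augment_derivProd (σ : ℕ → 𝒢) {L : Finset ℕ} {ℓ : ℕ} (hℓ : ℓ ∈ L) {n : ℤ} (hodd : Odd n)
    (hn : n ∣ (ℓ : ℤ) + 1) : n ∣ MonoidAlgebra.lift ℤ ℤ 𝒢 1 (derivProd σ L) := by
  rw [augment_derivProd]
  exact (dvd_augment_derivElt (σ ℓ) ℓ hodd hn).trans (Finset.dvd_prod_of_mem _ hℓ)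

/-! ### §3 `φ(P_n) = #(𝒢/H) · ε(D_n) · φ(y)`; vanishing -/

/-- **`φ (P_n) = #(𝒢/H) · ε(D_n) · φ y`** for an additive `φ` constant on the `𝒢`-orbit of `y` (`P_n = Σ_{q ∈ 𝒢/H} f(q) · D_n y`,
Gross (4.1)). [cite: GrossLMS1991, §4 (4.1)] -/
theorem map_kolyvaginPoint_eq_card_smul (φ : A →+ B) {y : A} (hφ : ∀ g : 𝒢, φ (g • y) = φ y)
    (σ : ℕ → 𝒢) (L : Finset ℕ) {H : Subgroup 𝒢} [Fintype (𝒢 ⧸ H)] (f : 𝒢 ⧸ H → 𝒢) :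
    φ (kolyvaginPoint σ L f y) =
      (Fintype.card (𝒢 ⧸ H) : ℤ) • ((MonoidAlgebra.lift ℤ ℤ 𝒢 1 (derivProd σ L)) • φ y) := by
  unfold kolyvaginPoint
  rw [map_sum]
  have : ∀ q : 𝒢 ⧸ H, φ (f q • grAct A (derivProd σ L) y) = (MonoidAlgebra.lift ℤ ℤ 𝒢 1 (derivProd σ L)) • φ y := by
    intro q
    rw [smul_grAct, map_grAct_eq_augment_smul φ hφ, map_mul, augment_of, one_mul]
  simp_rw [this]
  rw [Finset.sum_const, Finset.card_univ, ← natCast_zsmul]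

/-- **VANISHING.** If `φ : A → B` is additive and constant on the `𝒢`-orbit of `y`, `B` is killed by an odd integer `n`, and the
level `L` contains a prime `ℓ` with `n ∣ ℓ + 1`, then `φ (P_n) = 0` for EVERY presentation `(σ, H, f)`. Reading (19109's line, PORT MAP
§1): `A = E(K[n])`, `B = E(K[n]_w) ⧸ E⁰(K[n]_w) ≅ Φ_w = ℤ/3` at the additive carrier, `φ` = the component map after localisation at
`w`, orbit-constancy = «`g • ys n − ys n ∈ E⁰_w`» (one orientation ⇒ one component), `n = 3^M`, `ℓ` a Kolyvagin prime dividing the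
conductor: the Kolyvagin point `P_n` lies in `E⁰(K[n]_w)`, i.e. the deep-level class is STRICT at `w` — the `h49` input of the ported
walk — WITHOUT the rational-torsion clause of (B6). [cite: GrossLMS1991, §4 (4.1)] [cite: Zhang2001Heights, §4.4 Case 2]
[cite: Jetchev2008, Prop. 4.9 (p. 820)] -/
theorem map_kolyvaginPoint_eq_zero_of_orbitConstant (φ : A →+ B) {y : A} (hφ : ∀ g : 𝒢, φ (g • y) = φ y)
    {n : ℤ} (hodd : Odd n) (hB : ∀ b : B, n • b = 0)
    (σ : ℕ → 𝒢) {L : Finset ℕ} {ℓ : ℕ} (hℓ : ℓ ∈ L) (hn : n ∣ (ℓ : ℤ) + 1)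
    {H : Subgroup 𝒢} [Fintype (𝒢 ⧸ H)] (f : 𝒢 ⧸ H → 𝒢) :
    φ (kolyvaginPoint σ L f y) = 0 := by
  rw [map_kolyvaginPoint_eq_card_smul φ hφ σ L f]
  obtain ⟨c, hc⟩ := dvd_augment_derivProd σ hℓ hodd hn
  rw [hc, mul_comm, mul_smul, hB, smul_zero, smul_zero]

/-- **The same for EVERY element of the subgroup generated by the orbit-differences being killed**: if `φ` vanishes on
`g • y − y` for all `g` (the form in which a label «`g • ys m − ys m ∈ E⁰_w`» is stated), it is constant on the orbit. [folklore] -/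
theorem orbitConstant_of_map_sub_eq_zero (φ : A →+ B) {y : A} (h : ∀ g : 𝒢, φ (g • y - y) = 0) (g : 𝒢) :
    φ (g • y) = φ y := by
  have := h g
  rwa [map_sub, sub_eq_zero] at this

end Summit.BirchSwinnertonDyer.Rank1Residual.X11b.Three.KolyvaginAugmentation

end
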